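import Summits.BirchSwinnertonDyer.BirchSwinnertonDyer.Theorems.BiquadraticEisensteinDescentHeegnerTwistCouplingInSupplySylvesterTwistPhiValuations
import Literature.RingTheory.DiscreteValuationRing.AdicCompletionHensel
import HarnessLib

set_option linter.dupNamespace false -- `Summit.BirchSwinnertonDyer.BirchSwinnertonDyer.Theorems.…` (summit = sub, D-0017)
set_option autoImplicit false

/-!
# Crux `HeegnerTwistCouplingInSupply` (stmt-BirchSwinnertonDyer-21381) — programme «TWISTED 3-ISOGENY DESCENT», file P5b:
# the `φ`-side at the INERT prime `p` of `F = ℚ(√6)`: an unramified norm-cube Ш-parameter is a local CUBE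

Route `BiquadraticEisensteinDescent` (cell `pub/bsd-wall`, width seat `bsd-wall-cm-bed-w4` g32; `--supports` 21381, helper). For the
`φ`-side datum `E_F = mordellCurve(−3c″²)`, `c″ = pω/3` (`ω² = 6`), partner `Y² = X³ + B²`, `B = 9c″ = 3pω`, the local image at a place
`v ∋ p` with `v ∌ 2, 3` and `v(p) = exp(−1)` (`p` inert and unramified) meets the unramified classes trivially:

* §1 ★ `exists_pow_three_eq_of_valuation_sub_one_lt` — HENSEL: a `1`-unit of `F_v` (`v ∤ 3`) is a cube (`X³ − m` at `1` in the Henselian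
  ring `𝒪_v`, tree `adicCompletionIntegers.henselianLocalRing`);
* §2 `exists_eq_cube_of_mul_sub_eq_cube` — valued-field algebra: `A(A − 2B) = X³`, `v(2) = 1`, `3 ∤ ord B`, `3 ∣ ord A` ⟹ `A` is a cube
  (`ord A < ord B`: `(A − 2B)/A` is a `1`-unit cube `n³`, `A²n³ = X³`, `A = (An/X)³`; `ord A ≥ ord B` contradicts `3 ∣ ord A`);
  `exists_eq_cube_phiDescent_of_three_dvd_log` — hence `phiDescent c P` with `3 ∣ ord` is a cube (`B = 9c`, `3 ∤ ord B`);
* §3 ★★ `exists_eq_cube_adicCompletion_of_inert` — `[C_u] ∈ Ш(E_F/F)`, `3 ∣ v(u)`, `v ∋ p` inert unramified, `v ∌ 2, 3` ⟹ `u ∈ F_v׳`.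

HONEST FRAMING: one local lemma of the `φ`-side box for ONE CM family; the box (P5c: units of `ℚ(√6)` and the certificate (h1)), the
assembly and BSD are untouched. THEOREMS ONLY (no `def`, no named fact, no sorry). Supports stmt-BirchSwinnertonDyer-21381.
[cite: SilvermanAEC2009, Thm. X.4.2 (a), Prop. X.4.9] [cite: Cassels1986, Ch. 4 Lemma 3.1 (Hensel)] [cite: CohenPazuki2009, §4]
-/

noncomputable section

open scoped Classical WithZero Valued

namespace Summit.BirchSwinnertonDyer.BirchSwinnertonDyer.Theorems.SylvesterTwistDescent

open Literature.NumberTheory.EllipticCurves Literature.NumberTheory.EllipticCurves.MordellDescent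
open IsDedekindDomain IsDedekindDomain.HeightOneSpectrum NumberField Polynomial
open WithZero (log exp)

/-! ## §1 Hensel: `1`-units are cubes away from `3` -/

/-- ★ **A `1`-unit of `F_v` is a cube when `v ∤ 3`** (Hensel's lemma for `X³ − m` at `1` in the Henselian ring `𝒪_v`; `3 ∈ 𝒪_vˣ`).
[cite: Cassels1986, Ch. 4 Lemma 3.1 (Hensel)] -/
theorem exists_pow_three_eq_of_valuation_sub_one_lt {F : Type} [Field F] [NumberField F] (v : HeightOneSpectrum (𝓞 F))
    (h3 : ((3 : ℕ) : 𝓞 F) ∉ v.asIdeal) {m : v.adicCompletion F} (hm : Valued.v (m - 1) < 1) :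
    ∃ n : v.adicCompletion F, m = n ^ 3 := by
  haveI : HenselianLocalRing 𝒪[v.adicCompletion F] := inferInstanceAs (HenselianLocalRing (v.adicCompletionIntegers F))
  have hint : (Valued.v (R := v.adicCompletion F)).Integers 𝒪[v.adicCompletion F] := Valuation.integer.integers _
  have hm1 : Valued.v m ≤ 1 := by
    have e : m = (m - 1) + 1 := by ring
    rw [e]
    exact le_trans (Valuation.map_add _ _ _) (max_le hm.le (by rw [Valuation.map_one]))
  obtain ⟨mO, hmO⟩ : ∃ mO : 𝒪[v.adicCompletion F], (mO : v.adicCompletion F) = m :=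
    ⟨⟨m, (Valuation.mem_valuationSubring_iff _ _).mpr hm1⟩, rfl⟩
  have hu3 : IsUnit (3 : 𝒪[v.adicCompletion F]) := by
    rw [hint.isUnit_iff_valuation_eq_one]
    have e3 : (((3 : 𝒪[v.adicCompletion F]) : v.adicCompletion F)) = 3 := map_ofNat (𝒪[v.adicCompletion F]).subtype 3
    have e3' : (3 : v.adicCompletion F) = algebraMap F (v.adicCompletion F) ((3 : ℕ) : F) := by rw [map_natCast, Nat.cast_ofNat]
    have hval3 : Valued.v (algebraMap F (v.adicCompletion F) ((3 : ℕ) : F)) = v.valuation F ((3 : ℕ) : F) :=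
      valuedAdicCompletion_eq_valuation' v _
    change Valued.v (((3 : 𝒪[v.adicCompletion F]) : v.adicCompletion F)) = 1
    rw [e3, e3', hval3, valuation_natCast_eq_one v h3]
  have hc : (X ^ 3 - C mO).eval 1 ∈ IsLocalRing.maximalIdeal 𝒪[v.adicCompletion F] := by
    rw [IsLocalRing.mem_maximalIdeal, mem_nonunits_iff, hint.isUnit_iff_valuation_eq_one]
    simp only [eval_sub, eval_pow, eval_X, eval_C, one_pow]
    apply ne_of_lt
    change Valued.v (((1 - mO : 𝒪[v.adicCompletion F]) : v.adicCompletion F)) < 1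
    have e : (((1 - mO : 𝒪[v.adicCompletion F]) : v.adicCompletion F)) = -(m - 1) := by push_cast; rw [hmO]; ring
    rw [e, Valuation.map_neg]
    exact hm
  have hd : IsUnit ((derivative (X ^ 3 - C mO)).eval 1) := by
    have e : (derivative (X ^ 3 - C mO)).eval 1 = 3 := by simp; norm_num
    rw [e]; exact hu3
  obtain ⟨z, hz, -⟩ := HenselianLocalRing.is_henselian (X ^ 3 - C mO) (monic_X_pow_sub_C mO three_ne_zero) 1 hc hd
  refine ⟨(z : v.adicCompletion F), ?_⟩
  have hz' : z ^ 3 = mO := by simpa [sub_eq_zero] using hz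
  have h := congrArg (fun t : 𝒪[v.adicCompletion F] => (t : v.adicCompletion F)) hz'
  simp only [SubmonoidClass.coe_pow] at h
  rw [← hmO, ← h]

/-! ## §2 Valued-field algebra of the descent values -/

/-- **`A(A − 2B) = X³`, `v(2) = 1`, `3 ∤ ord B`, `3 ∣ ord A` ⟹ `A` is a cube** (given that `1`-units are cubes).
[cite: SilvermanAEC2009, Prop. X.4.9] -/
theorem exists_eq_cube_of_mul_sub_eq_cube {L : Type*} [Field L] (V : Valuation L ℤᵐ⁰) (hH : ∀ m : L, V (m - 1) < 1 → ∃ n : L, m = n ^ 3)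
    (h2 : V 2 = 1) {A B X : L} (hA : A ≠ 0) (hB : ¬ (3 : ℤ) ∣ log (V B)) (h3A : (3 : ℤ) ∣ log (V A))
    (hAX : A * (A - 2 * B) = X ^ 3) : ∃ n : L, A = n ^ 3 := by
  have hB0 : B ≠ 0 := by rintro rfl; simp at hB
  have hVA : V A ≠ 0 := (V.ne_zero_iff).mpr hA
  have hVB : V B ≠ 0 := (V.ne_zero_iff).mpr hB0
  have hV2B : V (2 * B) = V B := by rw [map_mul, h2, one_mul]
  have hX3 : V A * V (A - 2 * B) = V X ^ 3 := by rw [← map_mul, hAX, map_pow]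
  rcases lt_trichotomy (V A) (V (2 * B)) with hlt | heq | hgt
  · -- `ord A > ord B`: `V (A − 2B) = V B`, so `3 ∣ ord A + ord B`, `3 ∣ ord B`
    exfalso
    have hsub : V (A - 2 * B) = V B := by
      rw [sub_eq_add_neg, V.map_add_of_distinct_val (by rw [Valuation.map_neg]; exact hlt.ne), Valuation.map_neg, hV2B]
      exact max_eq_right (by rw [hV2B] at hlt; exact hlt.le)
    rw [hsub] at hX3
    have hVX : V X ≠ 0 := by
      intro h0; rw [h0, zero_pow three_ne_zero, mul_eq_zero] at hX3; exact hX3.elim hVA hVB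
    have hlog := congrArg log hX3
    rw [WithZero.log_mul hVA hVB, WithZero.log_pow, nsmul_eq_mul] at hlog
    push_cast at hlog
    obtain ⟨k, hk⟩ := h3A
    exact hB ⟨log (V X) - k, by linarith⟩
  · -- `ord A = ord B`
    exfalso
    rw [hV2B] at heq
    exact hB (by rw [← heq]; exact h3A)
  · -- `ord A < ord B`: `(A − 2B)/A` is a `1`-unit, hence a cube
    have hm : V ((A - 2 * B) / A - 1) < 1 := by
      have e : (A - 2 * B) / A - 1 = -(2 * B) / A := by field_simp; ring
      rw [e, map_div₀, Valuation.map_neg, div_lt_one₀ (zero_lt_iff.mpr hVA)]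
      exact hgt
    obtain ⟨n, hn⟩ := hH _ hm
    have key : A ^ 2 * n ^ 3 = X ^ 3 := by
      rw [← hn, ← hAX]; field_simp
    have hn0 : n ≠ 0 := by
      rintro rfl
      have : V ((A - 2 * B) / A) = 0 := by rw [hn, zero_pow three_ne_zero, map_zero]
      have h1 : V ((A - 2 * B) / A) = 1 := by
        have e : (A - 2 * B) / A = ((A - 2 * B) / A - 1) + 1 := by ring
        rw [e, V.map_add_of_distinct_val (by rw [Valuation.map_one]; exact hm.ne), Valuation.map_one]
        exact max_eq_right hm.le
      rw [h1] at this; exact one_ne_zero this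
    have hX : X ≠ 0 := by
      rintro rfl
      rw [zero_pow three_ne_zero, mul_eq_zero] at key
      exact key.elim (pow_ne_zero 2 hA) (pow_ne_zero 3 hn0)
    refine ⟨A * n / X, ?_⟩
    rw [div_pow, eq_div_iff (pow_ne_zero 3 hX)]
    linear_combination (-A) * key

/-- **A descent value with `3 ∣ ord` is a cube**: for `P` on `Y² = X³ + 81c²` (so `B = 9c`), `v(2) = 1`, `3 ∤ ord B`: if
`3 ∣ ord (phiDescent c P)` then `phiDescent c P ∈ L׳`. [cite: SilvermanAEC2009, Thm. X.4.2 (a), Prop. X.4.9] -/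
theorem exists_eq_cube_phiDescent_of_three_dvd_log {L : Type*} [Field L] [CharZero L] (V : Valuation L ℤᵐ⁰)
    (hH : ∀ m : L, V (m - 1) < 1 → ∃ n : L, m = n ^ 3) (h2 : V 2 = 1) {c₀ : L} (hB : ¬ (3 : ℤ) ∣ log (V (9 * c₀)))
    (P : (mordellCurve (81 * c₀ ^ 2)).toAffine.Point) (h3 : (3 : ℤ) ∣ log (V (phiDescent c₀ P))) :
    ∃ n : L, phiDescent c₀ P = n ^ 3 := by
  have hB0 : (9 : L) * c₀ ≠ 0 := by intro h0; rw [h0] at hB; simp at hB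
  rcases P with _ | ⟨X, Y, hP⟩
  · exact ⟨1, by rw [← WeierstrassCurve.Affine.Point.zero_def, phiDescent_zero]; ring⟩
  · have hW : mordellCurve (81 * c₀ ^ 2) = mordellCurve ((9 * c₀) ^ 2) := by congr 1; ring
    have hE : Y ^ 2 = X ^ 3 + (9 * c₀) ^ 2 := (equation_iff_of_eq hW X Y).mp hP.1
    rw [phiDescent_some] at h3 ⊢
    split_ifs at h3 ⊢ with hY
    · exfalso
      have e : (18 : L) * c₀ = 2 * (9 * c₀) := by ring
      rw [e, map_pow, map_mul, h2, one_mul, WithZero.log_pow, nsmul_eq_mul] at h3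
      push_cast at h3
      have h32 : IsCoprime (3 : ℤ) 2 := by norm_num
      exact hB (h32.dvd_of_dvd_mul_left h3)
    · have hA : Y + 9 * c₀ ≠ 0 := fun h => hY (by linear_combination h)
      exact exists_eq_cube_of_mul_sub_eq_cube V hH h2 hA hB h3 (X := X) (by linear_combination hE)

/-! ## §3 The inert place of the `φ`-side -/

variable {F : Type} [Field F] [NumberField F] {ω : F} (hω : ω ^ 2 = 6) {p : ℕ} (hc' : (p * ω / 3 : F) ≠ 0) {D : F}
  (hD : D = -3 * (p * ω / 3) ^ 2) {u : F} (hu : u ≠ 0) (hsha : torsorClass hc' hD hu ∈ (mordellCurve D).sha)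

include hω hsha in
/-- ★★ **At the inert unramified `v ∋ p` (`v ∌ 2, 3`, `v(p) = exp(−1)`), a norm-cube Ш-parameter with `3 ∣ v(u)` is a CUBE in `F_v`**:
local necessity gives `phiDescent c″ P = u·w³` for a local point `P` of `Y² = X³ + (3pω)²`; its `ord` is `≡ 0 (mod 3)`, so it is a cube
by §2 (`B = 3pω` has `ord 1`), hence so is `u`. [cite: SilvermanAEC2009, Thm. X.4.2 (a), Prop. X.4.9] [cite: CohenPazuki2009, §4] -/
theorem exists_eq_cube_adicCompletion_of_inert (v : HeightOneSpectrum (𝓞 F)) (h2 : ((2 : ℕ) : 𝓞 F) ∉ v.asIdeal)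
    (h3 : ((3 : ℕ) : 𝓞 F) ∉ v.asIdeal) (hvp : v.valuation F (p : F) = exp (-1 : ℤ)) (h3u : (3 : ℤ) ∣ log (v.valuation F u)) :
    ∃ z : v.adicCompletion F, z ≠ 0 ∧ algebraMap F (v.adicCompletion F) u = z ^ 3 := by
  obtain ⟨P, w, hw0, hPw⟩ := exists_phiDescent_eq_adicCompletion_of_torsorClass_mem_sha hc' hD hu hsha v
  haveI : CharZero (v.adicCompletion F) :=
    charZero_of_injective_algebraMap (algebraMap F (v.adicCompletion F)).injective
  have hval : ∀ k : F, Valued.v (algebraMap F (v.adicCompletion F) k) = v.valuation F k :=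
    fun k => valuedAdicCompletion_eq_valuation' v k
  have hH : ∀ m : v.adicCompletion F, Valued.v (m - 1) < 1 → ∃ n : v.adicCompletion F, m = n ^ 3 :=
    fun m hm => exists_pow_three_eq_of_valuation_sub_one_lt v h3 hm
  have hV2 : Valued.v (2 : v.adicCompletion F) = 1 := by
    rw [show (2 : v.adicCompletion F) = algebraMap F (v.adicCompletion F) ((2 : ℕ) : F) by rw [map_natCast, Nat.cast_ofNat], hval,
      valuation_natCast_eq_one v h2]
  -- `B = 9c″ = 3pω` has `ord 1`
  have hB : ¬ (3 : ℤ) ∣ log (Valued.v ((9 : v.adicCompletion F) * algebraMap F (v.adicCompletion F) (p * ω / 3))) := by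
    have e : (9 : v.adicCompletion F) * algebraMap F (v.adicCompletion F) (p * ω / 3) =
        algebraMap F (v.adicCompletion F) ((3 : ℕ) * ((p : ℕ) * ω)) := by
      simp only [map_mul, map_natCast, map_div₀, map_ofNat]; push_cast; ring
    have hu0 : v.valuation F ω ≠ 0 := by rw [valuation_omega_eq_one hω v h2 h3]; exact one_ne_zero
    have hp0 : v.valuation F (p : F) ≠ 0 := by rw [hvp]; exact WithZero.coe_ne_zero
    rw [e, hval, map_mul, map_mul, valuation_natCast_eq_one v h3, one_mul, WithZero.log_mul hp0 hu0, hvp, WithZero.log_exp,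
      valuation_omega_eq_one hω v h2 h3, WithZero.log_one, add_zero]
    decide
  have h3' : (3 : ℤ) ∣ log (Valued.v (phiDescent (algebraMap F (v.adicCompletion F) (p * ω / 3)) P)) := by
    have hu0 : v.valuation F u ≠ 0 := (Valuation.ne_zero_iff _).mpr hu
    have hw0' : Valued.v w ≠ 0 := (Valuation.ne_zero_iff _).mpr hw0
    rw [hPw, map_mul, map_pow, hval, WithZero.log_mul hu0 (pow_ne_zero 3 hw0'), WithZero.log_pow, nsmul_eq_mul]
    push_cast
    exact dvd_add h3u (dvd_mul_right 3 _)
  obtain ⟨n, hn⟩ := exists_eq_cube_phiDescent_of_three_dvd_log Valued.v hH hV2 hB P h3'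
  have hn0 : n ≠ 0 := by
    rintro rfl
    rw [zero_pow three_ne_zero, hPw, mul_eq_zero] at hn
    rcases hn with h | h
    · exact hu ((map_eq_zero _).mp h)
    · exact hw0 (pow_eq_zero_iff three_ne_zero |>.mp h)
  refine ⟨n / w, div_ne_zero hn0 hw0, ?_⟩
  rw [div_pow, eq_div_iff (pow_ne_zero 3 hw0), ← hn, hPw]

end Summit.BirchSwinnertonDyer.BirchSwinnertonDyer.Theorems.SylvesterTwistDescent

end
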